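import Literature.NumberTheory.Transcendental.FormalLinearODE
import Literature.NumberTheory.Transcendental.ShidlovskyDerivedForms
import Mathlib.Tactic
import HarnessLib

/-!
# Shidlovsky's lemma, II: the auxiliary regular point

Second part of the formalization of Shidlovsky's lemma after K. Mahler, *Lectures on
transcendental numbers*, LNM 546, Ch. 3 [Mahler1976] (the "functional bad approximability" input
of [CalegariDimitrovTang2024, §3.2 Theorem 37]). The uniformity at the heart of the lemma
(Mahler's lemma (13), §56) is proved at an auxiliary **regular** point `c` of the system
`κ w′ = B w` (`κ(c) ≠ 0`), where a full fundamental matrix of formal solutions exists. This file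
sets up that point:

* `sh c : K[X] →+* K⟦X⟧`, `p ↦ p(c + t)` — expansion of polynomials at `c`; it commutes with the
  derivative (`derivative_sh`), is injective, and `sh c κ` is a unit iff `κ(c) ≠ 0`
  (`isUnit_sh`).
* `solSpace_eq_regular` — at a regular point the solutions of `κ w′ = B w` (coefficients expanded
  through `sh c`) are those of the regular system `w′ = (κ⁻¹B)(c+t) w`, so by
  `FormalODE.finrank_solSpace_one` they form an `m`-dimensional `K`-space (Mahler §49 (4)), and
  `K`-independent solutions are `K⟦t⟧`-independent (`linearIndependent_powerSeries_of_solutions`,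
  Mahler §49: `ord det w = 0`).
* `exists_killed_solutions` — **Mahler's lemma (3)** (§47, p. 59) in the form used in §54: if the
  derived forms `λ_1,…,λ_μ` (`μ < m`... ) satisfy a relation `d λ_{μ+1} = Σ_{i ≤ μ} a_i λ_i` with
  polynomials `d ≠ 0, a_i` (i.e. `λ` has rank `≤ μ`), then there are `m − μ` solutions
  `w_1,…,w_{m−μ}` at the regular point, linearly independent over `K⟦t⟧`, with
  `λ_h(w_k) = 0` for all `h ≤ μ`. Proof as printed: `w ↦ (λ_h(w))_{h ≤ μ}` maps the
  `m`-dimensional solution space `K`-linearly into the solution space of a `μ × μ` system, which has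
  dimension `≤ μ` (`FormalODE.finrank_solSpace_le`, Mahler's lemma (2)); rank–nullity.

## References
* [Mahler1976] K. Mahler, *Lectures on transcendental numbers*, LNM 546, Springer 1976,
  Ch. 3 §§47–49, 54.
* [CalegariDimitrovTang2024] F. Calegari, V. Dimitrov, Y. Tang, arXiv:2408.15403, §3.2 Thm 37.
-/

namespace Literature.NumberTheory.Transcendental

namespace Shidlovsky

open Polynomial Finset
open scoped PowerSeries

noncomputable section

variable {K : Type*} [Field K] {m : ℕ}

/-! ### Expansion of polynomials at a point `c` -/

/-- `sh c p = p(c + t) ∈ K⟦t⟧`: the Taylor expansion of a polynomial at `c`.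
[cite: Mahler1976, Ch. 3 §43 (the fields `K(z − c)`)] -/
def sh (c : K) : K[X] →+* K⟦X⟧ :=
  (Polynomial.coeToPowerSeries.ringHom (R := K)).comp (Polynomial.compRingHom (X + C c))

/-- `sh c p = ↑(p ∘ (X + c))`. [folklore] -/
theorem sh_apply (c : K) (p : K[X]) : sh c p = ((p.comp (X + C c) : K[X]) : K⟦X⟧) := rfl

/-- The expansion commutes with the derivative. [folklore] -/
theorem derivative_sh (c : K) (p : K[X]) :
    PowerSeries.derivative K (sh c p) = sh c (Polynomial.derivative p) := by
  rw [sh_apply, sh_apply, PowerSeries.derivative_coe, Polynomial.derivative_comp]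
  simp

/-- The constant term of `p(c + t)` is `p(c)`. [folklore] -/
theorem constantCoeff_sh (c : K) (p : K[X]) : PowerSeries.constantCoeff (sh c p) = p.eval c := by
  rw [sh_apply, ← PowerSeries.coeff_zero_eq_constantCoeff_apply, Polynomial.coeff_coe,
    Polynomial.coeff_zero_eq_eval_zero, Polynomial.eval_comp]
  simp

/-- `sh c` is injective. [folklore] -/
theorem sh_injective (c : K) : Function.Injective (sh c) := by
  intro p q h
  rw [sh_apply, sh_apply] at h
  have h1 : p.comp (X + C c) = q.comp (X + C c) := Polynomial.coe_inj.mp h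
  have h2 := congrArg (fun r : K[X] => r.comp (X - C c)) h1
  simp only [Polynomial.comp_assoc, add_comp, X_comp, C_comp] at h2
  have hX : (X - C c + C c : K[X]) = X := by ring
  rw [hX, Polynomial.comp_X, Polynomial.comp_X] at h2
  exact h2

/-- `sh c p ≠ 0` for `p ≠ 0`. [folklore] -/
theorem sh_ne_zero (c : K) {p : K[X]} (hp : p ≠ 0) : sh c p ≠ 0 := fun h =>
  hp (sh_injective c (by rw [h, map_zero]))

/-- At a regular point (`κ(c) ≠ 0`) the expansion `κ(c + t)` is a unit of `K⟦t⟧`.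
[cite: Mahler1976, Ch. 3 §48 ("ord κ = 0")] -/
theorem isUnit_sh {c : K} {κ : K[X]} (hc : κ.eval c ≠ 0) : IsUnit (sh c κ) :=
  PowerSeries.isUnit_iff_constantCoeff.mpr (by rw [constantCoeff_sh]; exact isUnit_iff_ne_zero.mpr hc)

/-! ### The solution space at a point, through `σ` -/

variable (σ : K[X] →+* K⟦X⟧)

/-- The solutions of `κ w′ = B w` with coefficients expanded through `σ` are the solution space
`FormalODE.solSpace (σ κ) (B.map σ)`. [folklore] -/
theorem isSol_iff_mem_solSpace (κ : K[X]) (B : Matrix (Fin m) (Fin m) K[X]) (w : Fin m → K⟦X⟧) :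
    IsSol σ κ B w ↔ w ∈ FormalODE.solSpace (σ κ) (B.map σ) := Iff.rfl

/-- `λ(w)` is `K`-linear in `w`. [folklore] -/
theorem evalForm_add_right (p : Fin m → K[X]) (w w' : Fin m → K⟦X⟧) :
    evalForm σ p (w + w') = evalForm σ p w + evalForm σ p w' := by
  simp only [evalForm, Pi.add_apply, mul_add, Finset.sum_add_distrib]

/-- `λ(r w) = r λ(w)` for constants `r`. [folklore] -/
theorem evalForm_smul_right (p : Fin m → K[X]) (r : K) (w : Fin m → K⟦X⟧) :
    evalForm σ p (r • w) = r • evalForm σ p w := by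
  simp only [evalForm, Pi.smul_apply, Finset.smul_sum, mul_smul_comm]

variable {σ}

/-! ### The regular point: normal form and dimension `m` -/

section Regular

variable [CharZero K] {c : K} {κ : K[X]} {B : Matrix (Fin m) (Fin m) K[X]}

/-- The coefficient matrix `(κ⁻¹ B)(c + t)` of the normalised system at a regular point.
[cite: Mahler1976, Ch. 3 §48] -/
def regMatrix (c : K) (κ : K[X]) (B : Matrix (Fin m) (Fin m) K[X]) (hc : κ.eval c ≠ 0) :
    Matrix (Fin m) (Fin m) K⟦X⟧ :=
  fun h k => ↑(isUnit_sh hc).unit⁻¹ * sh c (B h k)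

omit [CharZero K] in
/-- Entries of `regMatrix`. [folklore] -/
theorem regMatrix_apply (c : K) (κ : K[X]) (B : Matrix (Fin m) (Fin m) K[X]) (hc : κ.eval c ≠ 0)
    (h k : Fin m) : regMatrix c κ B hc h k = ↑(isUnit_sh hc).unit⁻¹ * sh c (B h k) := rfl

omit [CharZero K] in
/-- At a regular point, `κ w′ = B w` and `w′ = (κ⁻¹B) w` have the same solutions.
[cite: Mahler1976, Ch. 3 §48] -/
theorem solSpace_eq_regular (hc : κ.eval c ≠ 0) :
    FormalODE.solSpace (sh c κ) (B.map (sh c)) = FormalODE.solSpace 1 (regMatrix c κ B hc) := by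
  ext w
  rw [FormalODE.mem_solSpace, FormalODE.mem_solSpace]
  set u := (isUnit_sh hc).unit with hu
  have hu' : (u : K⟦X⟧) = sh c κ := (isUnit_sh hc).unit_spec
  refine forall_congr' fun h => ?_
  rw [one_mul]
  constructor
  · intro H
    have H' : (↑u⁻¹ : K⟦X⟧) * (sh c κ * PowerSeries.derivative K (w h)) =
        (↑u⁻¹ : K⟦X⟧) * ∑ k, (B.map (sh c)) h k * w k := by rw [H]
    rw [← hu', ← mul_assoc, Units.inv_mul, one_mul, Finset.mul_sum] at H'
    rw [H']
    refine Finset.sum_congr rfl fun k _ => ?_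
    rw [regMatrix_apply, Matrix.map_apply, ← hu, mul_assoc]
  · intro H
    rw [H, ← hu', Finset.mul_sum]
    refine Finset.sum_congr rfl fun k _ => ?_
    rw [regMatrix_apply, ← hu, ← mul_assoc, ← mul_assoc, Units.mul_inv, one_mul, Matrix.map_apply]

/-- **Mahler §49 (4): at a regular point the solution space has dimension `m`.**
[cite: Mahler1976, Ch. 3 §49 (4)] -/
theorem finrank_solSpace_regular (hc : κ.eval c ≠ 0) :
    Module.finrank K (FormalODE.solSpace (sh c κ) (B.map (sh c))) = m := by
  rw [solSpace_eq_regular hc, FormalODE.finrank_solSpace_one]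

/-- The regular solution space is finite-dimensional. [folklore] -/
instance finite_solSpace_regular (q : Matrix (Fin m) (Fin m) K⟦X⟧) :
    Module.Finite K (FormalODE.solSpace 1 q) :=
  Module.Finite.equiv (FormalODE.solEquiv q)

/-- **`K`-independent solutions of a regular system are `K⟦t⟧`-independent** (compare lowest-order
coefficients: a `K⟦t⟧`-relation yields a `K`-relation among the constant parts, and a solution with
vanishing constant part is zero). [cite: Mahler1976, Ch. 3 §49 ("ord det w = 0")] -/
theorem linearIndependent_powerSeries_of_solutions {q : Matrix (Fin m) (Fin m) K⟦X⟧} {ι : Type*}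
    {w : ι → Fin m → K⟦X⟧} (hw : ∀ i, w i ∈ FormalODE.solSpace 1 q) (hli : LinearIndependent K w) :
    LinearIndependent K⟦X⟧ w := by
  classical
  rw [linearIndependent_iff']
  intro s g hsum
  by_contra hne
  push Not at hne
  obtain ⟨i₁, hi₁, hgi₁⟩ := hne
  set t := s.filter (fun i => g i ≠ 0) with ht
  have htne : t.Nonempty := ⟨i₁, Finset.mem_filter.mpr ⟨hi₁, hgi₁⟩⟩
  obtain ⟨i₀, hi₀, hmin⟩ := t.exists_min_image (fun i => (g i).order.toNat) htne
  obtain ⟨hi₀s, hgi₀⟩ := Finset.mem_filter.mp hi₀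
  set e := (g i₀).order.toNat with he
  set γ : ι → K := fun i => PowerSeries.coeff e (g i) with hγ
  have hγ0 : γ i₀ ≠ 0 := PowerSeries.coeff_order hgi₀
  -- the `t^e`-coefficient of the relation: `Σ γ_i · w_i(0) = 0`
  have hconst : ∀ j, ∑ i ∈ s, γ i * PowerSeries.constantCoeff (w i j) = 0 := by
    intro j
    have hj : ∑ i ∈ s, g i * w i j = 0 := by
      have := congrFun hsum j
      simpa [Finset.sum_apply, Pi.smul_apply, smul_eq_mul] using this
    have hcoeff := congrArg (PowerSeries.coeff e) hj
    rw [map_sum, map_zero] at hcoeff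
    rw [← hcoeff]
    refine Finset.sum_congr rfl fun i hi => ?_
    by_cases hgi : g i = 0
    · simp [hγ, hgi]
    · rw [PowerSeries.coeff_mul, Finset.sum_eq_single (e, 0)]
      · rw [PowerSeries.coeff_zero_eq_constantCoeff]
      · rintro ⟨a, b⟩ hab hne'
        have hab' : a + b = e := Finset.mem_antidiagonal.mp hab
        have ha : a < e := by
          rcases Nat.lt_or_ge a e with h | h
          · exact h
          · exfalso; apply hne'
            have : a = e := by omega
            subst this
            simp only [Prod.mk.injEq, true_and]; omega
        have hord : a < (g i).order.toNat := lt_of_lt_of_le ha (hmin i (Finset.mem_filter.mpr ⟨hi, hgi⟩))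
        rw [PowerSeries.coeff_of_lt_order_toNat _ hord, zero_mul]
      · intro h; exact absurd (Finset.mem_antidiagonal.mpr (by simp)) h
  -- hence `Σ γ_i w_i` is a solution with zero constant part, hence zero
  have hW : ∑ i ∈ s, γ i • w i ∈ FormalODE.solSpace 1 q :=
    Submodule.sum_mem _ fun i _ => Submodule.smul_mem _ _ (hw i)
  have hW0 : ∑ i ∈ s, γ i • w i = 0 := by
    refine FormalODE.eq_zero_of_constantCoeff_eq_zero q hW fun j => ?_
    rw [Finset.sum_apply, map_sum]
    simp only [Pi.smul_apply, PowerSeries.smul_eq_C_mul, map_mul, PowerSeries.constantCoeff_C]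
    exact hconst j
  have := linearIndependent_iff'.mp hli s γ hW0 i₀ hi₀s
  exact hγ0 this

/-! ### Mahler's lemma (3): solutions killed by a rank-deficient form -/

/-- The rank of a solution space of an `n × n` system is at most `n` (cardinal form of
`FormalODE.finrank_solSpace_le`). [cite: Mahler1976, Ch. 3 §45 lemma (2)] -/
theorem rank_solSpace_le {n : ℕ} {κ' : K⟦X⟧} (hκ' : κ' ≠ 0) (U : Matrix (Fin n) (Fin n) K⟦X⟧) :
    Module.rank K (FormalODE.solSpace κ' U) ≤ n := by
  classical
  apply rank_le
  intro s hs
  by_contra hlt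
  push Not at hlt
  have hli : LinearIndependent K (fun i : s => ((i : FormalODE.solSpace κ' U) : Fin n → K⟦X⟧)) :=
    hs.map' (FormalODE.solSpace κ' U).subtype (Submodule.ker_subtype _)
  have hle : n + 1 ≤ s.card := hlt
  let ι : Fin (n + 1) → s := fun k => s.equivFin.symm (Fin.castLE hle k)
  have hι : Function.Injective ι := fun a b hab =>
    Fin.castLE_injective hle (s.equivFin.symm.injective hab)
  exact FormalODE.solSpace_not_linearIndependent hκ' _ (fun k => ((ι k : s) : FormalODE.solSpace κ' U).2)
    (hli.comp ι hι)

omit [CharZero K] in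
/-- Linear algebra: if `r + dim(range Φ) ≤ dim V` then `ker Φ` contains `r` linearly independent
vectors. [folklore] -/
theorem exists_linearIndependent_ker {V W : Type*} [AddCommGroup V] [Module K V] [FiniteDimensional K V]
    [AddCommGroup W] [Module K W] (Φ : V →ₗ[K] W) {r : ℕ}
    (hr : r + Module.finrank K (LinearMap.range Φ) ≤ Module.finrank K V) :
    ∃ v : Fin r → V, LinearIndependent K v ∧ ∀ k, Φ (v k) = 0 := by
  have hker : r ≤ Module.finrank K (LinearMap.ker Φ) := by
    have h := LinearMap.finrank_range_add_finrank_ker Φ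
    omega
  let b := Module.finBasis K (LinearMap.ker Φ)
  let ι : Fin r → Fin (Module.finrank K (LinearMap.ker Φ)) := Fin.castLE hker
  refine ⟨fun k => (b (ι k) : V), ?_, fun k => LinearMap.mem_ker.mp (b (ι k)).2⟩
  have h1 : LinearIndependent K (fun k => b (ι k)) := b.linearIndependent.comp ι (Fin.castLE_injective hker)
  exact h1.map' (LinearMap.ker Φ).subtype (Submodule.ker_subtype _)

variable (c κ B)

/-- The `K`-linear map `w ↦ (λ_1(w), …, λ_μ(w))` on the solutions at the regular point `c`.
[cite: Mahler1976, Ch. 3 §47] -/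
def evalMap (hc : κ.eval c ≠ 0) (P : ℕ → Fin m → K[X]) (μ : ℕ) :
    FormalODE.solSpace 1 (regMatrix c κ B hc) →ₗ[K] (Fin μ → K⟦X⟧) where
  toFun w := fun h => evalForm (sh c) (P h) (w : Fin m → K⟦X⟧)
  map_add' w w' := by funext h; simp [evalForm_add_right]
  map_smul' r w := by funext h; simp [evalForm_smul_right]

variable {c κ B}

omit [CharZero K] in
/-- Unfolding `evalMap`. [folklore] -/
theorem evalMap_apply (hc : κ.eval c ≠ 0) (P : ℕ → Fin m → K[X]) (μ : ℕ)
    (w : FormalODE.solSpace 1 (regMatrix c κ B hc)) (h : Fin μ) :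
    evalMap c κ B hc P μ w h = evalForm (sh c) (P h) (w : Fin m → K⟦X⟧) := rfl

/-- The `μ × μ` system `Q*` satisfied by `(λ_1(w),…,λ_μ(w))` (Mahler §47): rows `h < μ − 1` are
`d · (shift)`, the last row holds the coefficients `a_i` of the relation `d λ_{μ+1} = Σ a_i λ_i`.
[cite: Mahler1976, Ch. 3 §47 (the system `Q*`)] -/
def starMatrix (c : K) (d : K[X]) {μ : ℕ} (a : Fin μ → K[X]) : Matrix (Fin μ) (Fin μ) K⟦X⟧ :=
  fun h k => if (h : ℕ) + 1 < μ then (if (k : ℕ) = (h : ℕ) + 1 then sh c d else 0) else sh c (a k)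

omit [CharZero K] in
/-- The values of the derived forms on a solution solve `Q*`. [cite: Mahler1976, Ch. 3 §47] -/
theorem evalMap_mem_solSpace (hc : κ.eval c ≠ 0) {P : ℕ → Fin m → K[X]}
    (hP : ∀ h, P (h + 1) = derivOp κ B (P h)) {μ : ℕ} {d : K[X]} {a : Fin μ → K[X]}
    (hrel : d • P μ = ∑ i, a i • P i) (w : FormalODE.solSpace 1 (regMatrix c κ B hc)) :
    (evalMap c κ B hc P μ w : Fin μ → K⟦X⟧) ∈ FormalODE.solSpace (sh c d * sh c κ) (starMatrix c d a) := by
  have hw : IsSol (sh c) κ B (w : Fin m → K⟦X⟧) := by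
    rw [isSol_iff_mem_solSpace, solSpace_eq_regular hc]; exact w.2
  have hder : ∀ h : ℕ, sh c κ * PowerSeries.derivative K (evalForm (sh c) (P h) (w : Fin m → K⟦X⟧)) =
      evalForm (sh c) (P (h + 1)) (w : Fin m → K⟦X⟧) := by
    intro h
    rw [hP h, evalForm_derivOp (sh c) (derivative_sh c) _ hw]
  intro h
  simp only [evalMap_apply]
  rw [mul_assoc, hder]
  unfold starMatrix
  by_cases hlt : (h : ℕ) + 1 < μ
  · simp only [hlt, if_true, ite_mul, zero_mul]
    rw [Finset.sum_eq_single (⟨(h : ℕ) + 1, hlt⟩ : Fin μ)]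
    · simp
    · intro x _ hx
      rw [if_neg]
      intro hx'
      exact hx (Fin.ext hx')
    · intro hx; exact absurd (Finset.mem_univ _) hx
  · -- last row: `h + 1 = μ`
    have hμ : (h : ℕ) + 1 = μ := by have := h.isLt; omega
    simp only [hlt, if_false]
    have : evalForm (sh c) (P ((h : ℕ) + 1)) (w : Fin m → K⟦X⟧) = evalForm (sh c) (P μ) (w : Fin m → K⟦X⟧) := by
      rw [hμ]
    rw [this, ← evalForm_smul, hrel, evalForm_sum]
    refine Finset.sum_congr rfl fun i _ => ?_
    rw [evalForm_smul]

/-- **Mahler's lemma (3)** (§47 (3), as used in §54): if the derived forms of `λ` satisfy a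
rank relation `d λ_{μ+1} = Σ_{i ≤ μ} a_i λ_i` (`d ≠ 0`), then at a regular point `c` there are
`m − μ` solutions `w_1,…,w_{m−μ}`, linearly independent over `K⟦t⟧`, annihilated by
`λ_1,…,λ_μ`. [cite: Mahler1976, Ch. 3 §47 lemma (3) (p. 59); §54] -/
theorem exists_killed_solutions (hc : κ.eval c ≠ 0) (hκ : κ ≠ 0) {P : ℕ → Fin m → K[X]}
    (hP : ∀ h, P (h + 1) = derivOp κ B (P h)) {μ : ℕ} {d : K[X]} (hd : d ≠ 0) {a : Fin μ → K[X]}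
    (hrel : d • P μ = ∑ i, a i • P i) :
    ∃ w : Fin (m - μ) → Fin m → K⟦X⟧, (∀ k, w k ∈ FormalODE.solSpace 1 (regMatrix c κ B hc)) ∧
      (∀ k, ∀ h : ℕ, h < μ → evalForm (sh c) (P h) (w k) = 0) ∧ LinearIndependent K⟦X⟧ w := by
  classical
  -- `dim range Φ ≤ μ` for `Φ = evalMap`
  have hrange : Module.finrank K (LinearMap.range (evalMap c κ B hc P μ)) ≤ μ := by
    apply Module.finrank_le_of_rank_le
    have h1 : LinearMap.range (evalMap c κ B hc P μ) ≤
        FormalODE.solSpace (sh c d * sh c κ) (starMatrix c d a) := by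
      rintro _ ⟨w, rfl⟩
      exact evalMap_mem_solSpace hc hP hrel w
    refine (Submodule.rank_mono h1).trans ?_
    exact rank_solSpace_le (mul_ne_zero (sh_ne_zero c hd) (sh_ne_zero c hκ)) _
  -- rank–nullity, in the abstract form `exists_linearIndependent_ker`
  have hV : Module.finrank K (FormalODE.solSpace 1 (regMatrix c κ B hc)) = m :=
    FormalODE.finrank_solSpace_one _
  have h3 := LinearMap.finrank_range_le (R := K) (evalMap c κ B hc P μ)
  obtain ⟨v, hvli, hvker⟩ := exists_linearIndependent_ker (evalMap c κ B hc P μ) (r := m - μ) (by omega)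
  refine ⟨fun k => (v k : Fin m → K⟦X⟧), fun k => (v k).2, fun k h hh => ?_, ?_⟩
  · have := congrFun (hvker k) ⟨h, hh⟩
    rw [evalMap_apply] at this
    exact this
  · exact linearIndependent_powerSeries_of_solutions (fun k => (v k).2)
      (hvli.map' (FormalODE.solSpace 1 (regMatrix c κ B hc)).subtype (Submodule.ker_subtype _))

end Regular

end

end Shidlovsky

end Literature.NumberTheory.Transcendental
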